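import Summits.BirchSwinnertonDyer.BirchSwinnertonDyer.Theorems.ThetaPartnerAtTwoSignedControlAtTwoSigmaDiv
import Summits.BirchSwinnertonDyer.BirchSwinnertonDyer.Theorems.PublishedInputsGreenbergLocalSurjectivityAtP
import Literature.NumberTheory.EllipticCurves.IwasawaEulerCharRankZeroAssemblyProofs
import HarnessLib

set_option linter.dupNamespace false -- `…BirchSwinnertonDyer.BirchSwinnertonDyer…` is the cell's nested layout (D-0017)
set_option autoImplicit false

/-!
# Greenberg LNM 1716 Lemma 4.7 / p. 108, the third vertical arrow: `(Sel_{p^∞}(E/K_∞))_Γ = 0` — the Cassels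
# descent for the CLASSICAL Selmer group, and its UNCONDITIONAL instance over `ℚ` at a good ORDINARY prime

Seat `bsd-inputs-k4-p1` (gen 4; LADDER-BSD D-0154 KEY (147)(f) «prove the printed input», row 1 K4 INPUTS; Greenberg
1999), `--supports stmt-BirchSwinnertonDyer-20309`. THEOREMS ONLY (no definition, no named fact, no `sorry`).

R. Greenberg, *Iwasawa theory for elliptic curves*, LNM 1716 (1999), §4 proof of Lemma 4.7, pp. 107–108: the exact second
row `H¹(F_Σ/F_∞, E[p^∞])^Γ → 𝒫_E^Σ(F_∞)^Γ → (Sel_E(F_∞)_p)_Γ → H¹(F_Σ/F_∞, E[p^∞])_Γ = 0` and "The surjectivity of the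
third vertical arrow follows" — i.e. `𝒫_E^Σ(F)/𝒢_E^Σ(F) ↠ (Sel_E(F_∞)_p)_Γ`; when `Sel_E(F)_p` is finite and `E(F)[p] = 0`
the source is `E(F) ⊗ ℚ_p/ℤ_p`-dual-free and the coinvariants VANISH (p. 104: `coker(𝒫^Σ(F) → ∏ 𝒫) ≅ (E(F)_p)^`). In
the tree's currency the statement is `(Sel_{p^∞}(E/K_∞))_γ = Sel_∞/(conj_γ − 1)Sel_∞ = 0`, i.e.
`Subsingleton (EndCoinvariants (W.conjSelmerInfty κ γ - 1))` — the factor `#(Sel_∞)_γ` of the tree's Lemma 4.2/4.3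
assembly `SelmerDualData.constantCoeff_charGenerator_mul_natCard_of_finite_selmerGroup` (Greenberg Thm. 4.1 road, memo
`K4P1-GREENBERG-THM41-SIZING.md` (M2) «COINV_ord»).

* §1 `exists_mem_selmerInfty_conjH1_sub_eq` — ANY number field `K`, CYCLOTOMIC `κ`, topological generator `γ`,
  `Sel_{p^∞}(E/K)` finite, `E[p^∞]^{Γ_K} = 0`, «DIV» for `H¹(K_∞, E[p^∞])` (`hdiv`) and Greenberg's local surjectivity
  `𝒫_E(K_v) ↠ 𝒫_E(K_{∞,η})^{Γ_{K_v}}` at EVERY finite place (`hsurj`, p. 108): every `s ∈ Sel_{p^∞}(E/K_∞)` is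
  `conj_γ t − t` with `t ∈ Sel_{p^∞}(E/K_∞)`. PROOF = Greenberg's diagram chase run as the K4 line's LIFT (the twin of this
  lineage's `SignedEC.SigmaDiv.forall_exists_conjH1_sub_eq_unramifiedOutside`, p635332, with the Selmer group as target):
  DIV gives `t`; AEU (`SignedEC.ResTwo.exists_finset_mem_unramifiedOutside`); `conj_σ t − t ∈ Sel_∞` for all `σ`
  (`SSFlatEC.conjH1_sub_mem_of_conjH1_generator_sub_mem`); local lifts at every finite place of `Σ` from `hsurj`
  (`SSFlatEC.exists_localLift_of_localSurj`) and at the archimedean places (`SSFlatEC.exists_localLift_infinitePlace_top`);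
  CASSELS (`InputsPoitouTateSelmer.casselsSurjectivity_H1Sigma_holds`, Prop. 4.13, a theorem for every `K`) realises them by
  one `y ∈ H¹(K_Σ/K, E[p^∞])`; then `t − res y ∈ Sel_∞` (off `Σ`: unramified ⟹ Kummer over the cyclotomic tower,
  `X2.GreenbergVatsalUnramifiedAway.unramKer_le_localKerOver_of_isCyclotomic`) and `conj_γ (t − res y) − (t − res y) = s`.
* §2 `subsingleton_endCoinvariants_conjSelmerInfty` — hence **`(Sel_{p^∞}(E/K_∞))_γ = 0`**, same hypotheses.
* §3 `subsingleton_endCoinvariants_conjSelmerInfty_ordinary_rat` — **UNCONDITIONAL over `ℚ` at a good ORDINARY prime**: for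
  `W/ℚ` globally minimal with `GoodOrd W p`, `κ` cyclotomic with topological generator `γ`, `Sel_{p^∞}(E/ℚ)` finite and
  `E(ℚ)[p] = 0`: `(Sel_{p^∞}(E/ℚ_∞))_γ = 0` — `hdiv` by `SignedEC.PrimaryTorsionH2.forall_exists_conjH1_sub_eq_real`
  (Poitou–Tate over `ℚ`), `hsurj` by `InputsGreenbergLocalAtP.exists_primary_resOfLe_eq_of_forall_conjH1_eq_all`
  (this seat's LOC_ord@p + bsd-2adic's `v ∤ p`).

HONEST FRAMING: §3 is Greenberg's printed conclusion «`(Sel_E(F_∞)_p)_Γ = 0`» for `F = ℚ`, good ordinary `p`, in the regime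
`Sel` finite ∧ `E(ℚ)[p] = 0`, re-derived from tree theorems (finite-level Poitou–Tate, Cassels, Coates–Greenberg, local
duality); it is ONE factor of Thm. 4.1, not Thm. 4.1 (the count `#ker g = ∏ c_ℓ · #Ẽ(𝔽_p)²` is not touched here); no item
is closed; no summit statement is proved; BSD is not proved by any of this.

References: [GreenbergLNM1716] §4 p. 104, Lemma 4.7 (pp. 107–108), Prop. 4.13 (p. 122); [GreenbergVatsal2000] §2 pp. 16–17;
[MilneADT2006] I Thm. 4.10; [SilvermanAEC2009] Cor. X.4.4.
-/

noncomputable section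

open scoped Classical NumberField

open NumberField IsDedekindDomain Field

namespace Summit.BirchSwinnertonDyer.BirchSwinnertonDyer.Theorems.InputsGreenbergSelmerCoinv

open Literature.NumberTheory.EllipticCurves Literature.NumberTheory.GaloisRepresentations
  WeierstrassCurve ZpExtension Literature.NumberTheory.EllipticCurves.IwasawaAlgebra
  Literature.NumberTheory.EllipticCurves.IwasawaDual
  Literature.NumberTheory.EllipticCurves.GreenbergVatsal2000 Literature.NumberTheory.EllipticCurves.GreenbergSelmer
  Literature.NumberTheory.EllipticCurves.Rank1Residual Summit.BirchSwinnertonDyer.Rank1Residual.X2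

variable {K : Type} [Field K] [NumberField K] (W : WeierstrassCurve K) [W.IsElliptic] (p : ℕ) [hp : Fact p.Prime]
  (κ : ZpExtension K p) {γ : absoluteGaloisGroup K}

/-! ## §1 The Cassels descent for `Sel_{p^∞}(E/K_∞)`: every Selmer class is `conj_γ t − t` with `t` Selmer -/

/-- **Greenberg LNM 1716 Lemma 4.7 / p. 108, third vertical arrow, in the regime `Sel_{p^∞}(E/K)` finite, `E[p^∞]^{Γ_K} = 0`:
every `s ∈ Sel_{p^∞}(E/K_∞)` is `conj_γ t − t` with `t ∈ Sel_{p^∞}(E/K_∞)`**, for `W/K` elliptic over a number field,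
`κ` the cyclotomic `ℤ_p`-extension with topological generator `γ`, GIVEN «DIV» for the full group `H¹(K_∞, E[p^∞])` (`hdiv`)
and the local surjectivity `𝒫_E(K_v)[p^∞] ↠ (𝒫_E(K_{∞,η})[p^∞])^{Γ_{K_v}}` at every finite place (`hsurj`, p. 108). See the
module docstring for the chase. [cite: GreenbergLNM1716, §4 p. 104, Lemma 4.7 (pp. 107–108), Prop. 4.13 (p. 122)]
[cite: GreenbergVatsal2000, §2 pp. 16–17] [cite: SilvermanAEC2009, Cor. X.4.4] -/
theorem exists_mem_selmerInfty_conjH1_sub_eq (hκ : κ.IsCyclotomic) (hγ : κ.IsTopGenerator γ)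
    (hSel : Finite (W.selmerGroupPInfty p))
    (hE : Nat.card (MulAction.fixedPoints (absoluteGaloisGroup K) (W.geomPrimaryTorsion p)) = 1)
    (hdiv : ∀ s : W.subgroupH1 p κ.kerSubgroup,
      ∃ t : W.subgroupH1 p κ.kerSubgroup, W.conjH1 p κ.kerSubgroup γ t - t = s)
    (hsurj : ∀ (v : HeightOneSpectrum (𝓞 K))
      (c : discreteH1 (localSubgroup κ.kerSubgroup (v.adicCompletion K)) (localPoints W (v.adicCompletion K))),
      (∃ k : ℕ, p ^ k • c = 0) →
      (∀ δ : absoluteGaloisGroup (v.adicCompletion K),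
        Literature.NumberTheory.EllipticCurves.conjH1 (localSubgroup κ.kerSubgroup (v.adicCompletion K))
          (localPoints W (v.adicCompletion K)) δ c = c) →
      ∃ x : discreteH1 (localSubgroup (⊤ : Subgroup (absoluteGaloisGroup K)) (v.adicCompletion K))
          (localPoints W (v.adicCompletion K)),
        (∃ k : ℕ, p ^ k • x = 0) ∧
        Literature.NumberTheory.EllipticCurves.resOfLe (localPoints W (v.adicCompletion K))
          (Subgroup.comap_mono le_top :
            localSubgroup κ.kerSubgroup (v.adicCompletion K) ≤
              localSubgroup (⊤ : Subgroup (absoluteGaloisGroup K)) (v.adicCompletion K)) x = c)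
    (s : W.subgroupH1 p κ.kerSubgroup) (hs : s ∈ W.selmerInfty κ) :
    ∃ t ∈ W.selmerInfty κ, W.conjH1 p κ.kerSubgroup γ t - t = s := by
  set Sel : AddSubgroup (W.subgroupH1 p κ.kerSubgroup) := W.selmerInfty κ with hSeldef
  obtain ⟨t, ht⟩ := hdiv s -- DIV in the full group `H¹(K_∞, E[p^∞])`
  -- `Sel_∞` is `Γ_K`-stable, so every `conj_σ t − t` lies in `Sel_∞`
  have hstab : ∀ (σ : absoluteGaloisGroup K), ∀ x ∈ Sel, W.conjH1 p κ.kerSubgroup σ x ∈ Sel := fun σ x hx ↦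
    W.map_conjH1_selmerGroupOver_le_holds p κ.kerSubgroup σ ⟨x, hx, rfl⟩
  have htγ : W.conjH1 p κ.kerSubgroup γ t - t ∈ Sel := by rw [ht]; exact hs
  have htall : ∀ σ : absoluteGaloisGroup K, W.conjH1 p κ.kerSubgroup σ t - t ∈ Sel :=
    SSFlatEC.conjH1_sub_mem_of_conjH1_generator_sub_mem W κ hγ Sel hstab htγ
  have hone : ∀ {A : AddSubgroup (W.subgroupH1 p κ.kerSubgroup)} {z : W.subgroupH1 p κ.kerSubgroup},
      W.conjH1 p κ.kerSubgroup 1 z ∈ A → z ∈ A := fun {A z} h ↦ by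
    rwa [W.conjH1_one_holds p κ.kerSubgroup, AddMonoidHom.id_apply] at h
  have hsel' : ∀ σ, (∀ (v : HeightOneSpectrum (𝓞 K)) (τ : absoluteGaloisGroup K),
      W.conjH1 p κ.kerSubgroup τ (W.conjH1 p κ.kerSubgroup σ t - t) ∈ W.localKerOver p κ.kerSubgroup (v.adicCompletion K)) ∧
      ∀ (w : InfinitePlace K) (τ : absoluteGaloisGroup K),
        W.conjH1 p κ.kerSubgroup τ (W.conjH1 p κ.kerSubgroup σ t - t) ∈ W.localKerOver p κ.kerSubgroup w.Completion :=
    fun σ ↦ (W.mem_selmerGroupOver_iff p κ.kerSubgroup _).mp (htall σ)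
  -- AEU: `t` is unramified outside a finite `S₁` containing the bad places
  obtain ⟨S₁, hgood₁, htH⟩ := SignedEC.ResTwo.exists_finset_mem_unramifiedOutside W p κ.kerSubgroup t
  -- `Sel_∞` satisfies the classical Kummer condition at the chosen place above every finite `v`
  have hle : ∀ v : HeightOneSpectrum (𝓞 K), Sel ≤ W.localKerOver p κ.kerSubgroup (v.adicCompletion K) :=
    fun v x hx ↦ hone (((W.mem_selmerGroupOver_iff p κ.kerSubgroup x).mp hx).1 v 1)
  -- local lifts at every finite place (Greenberg p. 108) and at the archimedean places
  have hloc : ∀ v : HeightOneSpectrum (𝓞 K),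
      ∃ xv : discreteH1 (localSubgroup (⊤ : Subgroup (absoluteGaloisGroup K)) (v.adicCompletion K))
          (localPoints W (v.adicCompletion K)),
        (∃ k : ℕ, p ^ k • xv = 0) ∧
        ∀ y : W.subgroupH1 p (⊤ : Subgroup (absoluteGaloisGroup K)),
          W.localResOver p ⊤ (v.adicCompletion K) y = xv →
          t - W.resOfLe p (le_top : κ.kerSubgroup ≤ ⊤) y ∈ W.localKerOver p κ.kerSubgroup (v.adicCompletion K) :=
    fun v ↦ SSFlatEC.exists_localLift_of_localSurj W κ (hsurj v) Sel (hle v) t htall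
  have hinf := fun w : InfinitePlace K ↦ SSFlatEC.exists_localLift_infinitePlace_top W κ w t
  let x : ∀ v : HeightOneSpectrum (𝓞 K),
      discreteH1 (localSubgroup (⊤ : Subgroup (absoluteGaloisGroup K)) (v.adicCompletion K))
        (localPoints W (v.adicCompletion K)) := fun v ↦ Classical.choose (hloc v)
  let xi : ∀ w : InfinitePlace K,
      discreteH1 (localSubgroup (⊤ : Subgroup (absoluteGaloisGroup K)) w.Completion) (localPoints W w.Completion) :=
    fun w ↦ Classical.choose (hinf w)
  -- CASSELS over `K` with the finite set `S₁`
  obtain ⟨y, hyH, hyfin, hyinf⟩ := InputsPoitouTateSelmer.casselsSurjectivity_H1Sigma_holds K W p hSel hE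
    (↑S₁ : Set (HeightOneSpectrum (𝓞 K))) S₁.finite_toSet
    (fun v hv hpv ↦ hgood₁ v (fun h ↦ hv (Finset.mem_coe.mpr h)) hpv) x xi
    (fun v ↦ (Classical.choose_spec (hloc v)).1) (fun w ↦ (Classical.choose_spec (hinf w)).1)
  have hsplit : ∀ σ : absoluteGaloisGroup K,
      W.conjH1 p κ.kerSubgroup σ (t - W.resOfLe p (le_top : κ.kerSubgroup ≤ ⊤) y) =
        (W.conjH1 p κ.kerSubgroup σ t - t) + (t - W.resOfLe p (le_top : κ.kerSubgroup ≤ ⊤) y) := fun σ ↦ by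
    rw [map_sub, SSFlatEC.conjH1_resOfLe_top W κ σ y]; abel
  -- `res y` is unramified outside `S₁` over `K_∞`
  have hyH' : W.resOfLe p (le_top : κ.kerSubgroup ≤ ⊤) y ∈
      unramifiedOutside κ.kerSubgroup (W.geomPrimaryTorsion p) p (↑S₁ : Set (HeightOneSpectrum (𝓞 K))) :=
    SSFlatEC.resOfLe_mem_unramifiedOutside (W.geomPrimaryTorsion p) (le_top : κ.kerSubgroup ≤ ⊤) p _ hyH
  refine ⟨t - W.resOfLe p (le_top : κ.kerSubgroup ≤ ⊤) y, ?_, ?_⟩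
  · -- membership in `Sel_{p^∞}(E/K_∞)`
    refine (W.mem_selmerGroupOver_iff p κ.kerSubgroup _).mpr ⟨fun v σ ↦ ?_, fun w σ ↦ ?_⟩
    · rw [hsplit σ]
      refine AddSubgroup.add_mem _ (hone ((hsel' σ).1 v 1)) ?_
      by_cases h1 : (v ∈ (↑S₁ : Set (HeightOneSpectrum (𝓞 K))) ∨ ((p : ℕ) : 𝓞 K) ∈ v.asIdeal)
      · -- `v ∈ Σ`: Kummer by the choice of `x v`
        exact (Classical.choose_spec (hloc v)).2 y (hyfin v h1)
      · -- `v ∉ Σ`: both `t` and `res y` are unramified at `v`, hence Kummer over the cyclotomic tower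
        obtain ⟨hv, hpv⟩ := not_or.mp h1
        have hv' : v ∉ S₁ := fun h ↦ hv (Finset.mem_coe.mpr h)
        have h2 : W.conjH1 p κ.kerSubgroup 1 t ∈ W.localKerOver p κ.kerSubgroup (v.adicCompletion K) :=
          GreenbergVatsalUnramifiedAway.unramKer_le_localKerOver_of_isCyclotomic (κ := κ) (v := v) (W := W) (p := p)
            hκ (hgood₁ v hv' hpv) hpv ((mem_unramifiedOutside_iff t).mp htH v hv hpv 1)
        have h3 : W.conjH1 p κ.kerSubgroup 1 (W.resOfLe p (le_top : κ.kerSubgroup ≤ ⊤) y) ∈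
            W.localKerOver p κ.kerSubgroup (v.adicCompletion K) :=
          GreenbergVatsalUnramifiedAway.unramKer_le_localKerOver_of_isCyclotomic (κ := κ) (v := v) (W := W) (p := p)
            hκ (hgood₁ v hv' hpv) hpv ((mem_unramifiedOutside_iff _).mp hyH' v hv hpv 1)
        exact AddSubgroup.sub_mem _ (hone h2) (hone h3)
    · rw [hsplit σ]
      exact AddSubgroup.add_mem _ (hone ((hsel' σ).2 w 1)) ((Classical.choose_spec (hinf w)).2 y (hyinf w))
  · -- `(conj_γ − 1)(t − res y) = (conj_γ − 1) t = s`
    rw [map_sub, SSFlatEC.conjH1_resOfLe_top W κ γ y, ← ht]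
    abel

/-! ## §2 `(Sel_{p^∞}(E/K_∞))_γ = 0` -/

/-- **`(Sel_{p^∞}(E/K_∞))_γ = Sel_∞/(conj_γ − 1)Sel_∞ = 0`** (Greenberg LNM 1716 p. 108, the third vertical arrow of Lemma 4.7
in the regime `Sel_{p^∞}(E/K)` finite, `E[p^∞]^{Γ_K} = 0`): `Subsingleton (EndCoinvariants (W.conjSelmerInfty κ γ - 1))`, for
`W/K` elliptic over a number field, `κ` cyclotomic with topological generator `γ`, GIVEN «DIV» for `H¹(K_∞, E[p^∞])` and the
p. 108 local surjectivity at every finite place. [cite: GreenbergLNM1716, §4 p. 104 and Lemma 4.7 (pp. 107–108)] -/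
theorem subsingleton_endCoinvariants_conjSelmerInfty (hκ : κ.IsCyclotomic) (hγ : κ.IsTopGenerator γ)
    (hSel : Finite (W.selmerGroupPInfty p))
    (hE : Nat.card (MulAction.fixedPoints (absoluteGaloisGroup K) (W.geomPrimaryTorsion p)) = 1)
    (hdiv : ∀ s : W.subgroupH1 p κ.kerSubgroup,
      ∃ t : W.subgroupH1 p κ.kerSubgroup, W.conjH1 p κ.kerSubgroup γ t - t = s)
    (hsurj : ∀ (v : HeightOneSpectrum (𝓞 K))
      (c : discreteH1 (localSubgroup κ.kerSubgroup (v.adicCompletion K)) (localPoints W (v.adicCompletion K))),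
      (∃ k : ℕ, p ^ k • c = 0) →
      (∀ δ : absoluteGaloisGroup (v.adicCompletion K),
        Literature.NumberTheory.EllipticCurves.conjH1 (localSubgroup κ.kerSubgroup (v.adicCompletion K))
          (localPoints W (v.adicCompletion K)) δ c = c) →
      ∃ x : discreteH1 (localSubgroup (⊤ : Subgroup (absoluteGaloisGroup K)) (v.adicCompletion K))
          (localPoints W (v.adicCompletion K)),
        (∃ k : ℕ, p ^ k • x = 0) ∧
        Literature.NumberTheory.EllipticCurves.resOfLe (localPoints W (v.adicCompletion K))
          (Subgroup.comap_mono le_top :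
            localSubgroup κ.kerSubgroup (v.adicCompletion K) ≤
              localSubgroup (⊤ : Subgroup (absoluteGaloisGroup K)) (v.adicCompletion K)) x = c) :
    Subsingleton (EndCoinvariants (W.conjSelmerInfty κ γ - 1)) := by
  refine subsingleton_of_forall_eq 0 fun q ↦ ?_
  induction q using QuotientAddGroup.induction_on with
  | H s =>
    obtain ⟨t, htS, ht⟩ := exists_mem_selmerInfty_conjH1_sub_eq W p κ hκ hγ hSel hE hdiv hsurj s s.2
    refine (endCoinvariants_mk_eq_zero_iff _ s).mpr ⟨⟨t, htS⟩, ?_⟩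
    apply Subtype.ext
    rw [End_sub_apply, AddMonoid.End.one_apply, AddSubgroupClass.coe_sub, coe_conjSelmerInfty_apply]
    exact ht

/-! ## §3 Over `ℚ` at a good ORDINARY prime — unconditional -/

/-- **`(Sel_{p^∞}(E/ℚ_∞))_γ = 0` at a good ORDINARY prime — UNCONDITIONAL** (Greenberg LNM 1716 §4 p. 104 / Lemma 4.7
pp. 107–108, `F = ℚ`): for `W/ℚ` globally minimal and elliptic with good ordinary reduction at `p` (`GoodOrd W p`), `κ` the
cyclotomic `ℤ_p`-extension with topological generator `γ`, `Sel_{p^∞}(E/ℚ)` finite and `E(ℚ)[p] = 0`,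
`Subsingleton (EndCoinvariants (W.conjSelmerInfty κ γ - 1))`. «DIV» by `SignedEC.PrimaryTorsionH2.forall_exists_conjH1_sub_eq_real`
(Poitou–Tate over `ℚ`), the local surjectivity at every finite place by
`InputsGreenbergLocalAtP.exists_primary_resOfLe_eq_of_forall_conjH1_eq_all` (LOC_ord@p, this seat; `v ∤ p` cell bsd-2adic).
[cite: GreenbergLNM1716, §4 p. 104 and Lemma 4.7 (pp. 107–108)] [cite: MilneADT2006, I Thm. 4.10, Cor. 4.16] -/
theorem subsingleton_endCoinvariants_conjSelmerInfty_ordinary_rat (W : WeierstrassCurve ℚ) [W.IsGloballyMinimal]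
    [W.IsElliptic] (hgo : GoodOrd W p) (κ : ZpExtension ℚ p) (hκ : κ.IsCyclotomic) {γ : absoluteGaloisGroup ℚ}
    (hγ : κ.IsTopGenerator γ) [Finite (W.selmerGroupPInfty p)] (hK : ∀ P : W.toAffine.Point, p • P = 0 → P = 0) :
    Subsingleton (EndCoinvariants (W.conjSelmerInfty κ γ - 1)) :=
  -- (`convert` bridges the two `DecidableEq ℚ` instances behind the group law on `W.toAffine.Point`)
  subsingleton_endCoinvariants_conjSelmerInfty W p κ hκ hγ ‹_›
    (W.natCard_fixedPoints_absoluteGaloisGroup_geomPrimaryTorsion_eq_one (p := p) fun P hP ↦ hK P (by convert hP))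
    (SignedEC.PrimaryTorsionH2.forall_exists_conjH1_sub_eq_real W p κ hγ fun P hP ↦ hK P (by convert hP))
    (fun v c hc hfix ↦ InputsGreenbergLocalAtP.exists_primary_resOfLe_eq_of_forall_conjH1_eq_all W hgo κ hκ v c hc hfix)

/-- The same, numerically: **`#(Sel_{p^∞}(E/ℚ_∞))_γ = 1`** — the coinvariant factor of the tree's Lemma 4.2/4.3 assembly
`SelmerDualData.constantCoeff_charGenerator_mul_natCard_of_finite_selmerGroup` (Greenberg Thm. 4.1 road) at a good ordinary
prime with `Sel_{p^∞}(E/ℚ)` finite and `E(ℚ)[p] = 0`. [cite: GreenbergLNM1716, §4 Thm. 4.1 (p. 102), p. 104, Lemma 4.7] -/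
theorem natCard_endCoinvariants_conjSelmerInfty_ordinary_rat (W : WeierstrassCurve ℚ) [W.IsGloballyMinimal]
    [W.IsElliptic] (hgo : GoodOrd W p) (κ : ZpExtension ℚ p) (hκ : κ.IsCyclotomic) {γ : absoluteGaloisGroup ℚ}
    (hγ : κ.IsTopGenerator γ) [Finite (W.selmerGroupPInfty p)] (hK : ∀ P : W.toAffine.Point, p • P = 0 → P = 0) :
    Nat.card (EndCoinvariants (W.conjSelmerInfty κ γ - 1)) = 1 := by
  haveI := subsingleton_endCoinvariants_conjSelmerInfty_ordinary_rat p W hgo κ hκ hγ hK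
  exact Nat.card_unique

end Summit.BirchSwinnertonDyer.BirchSwinnertonDyer.Theorems.InputsGreenbergSelmerCoinv

end
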